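import Literature.Geometry.Riemannian.NormalExponentialMap
import Literature.Geometry.Riemannian.NormalExpGaussLemma
import Literature.Geometry.Riemannian.ExpMapGlobalSmooth
import Literature.Geometry.Riemannian.GaussLemma
import Literature.Geometry.Lorentzian.GeodesicProofs
import Mathlib.Analysis.InnerProductSpace.Calculus
import Mathlib.Analysis.SpecialFunctions.Trigonometric.Deriv
import HarnessLib

/-!
# The cone over a hypersurface along its unit normal is a radial isometry (Gauss identities)

Topic `Geometry/Riemannian`; support file of the programme towards the named fact
`Weinstein1968_exists_metric_two_le_multiplicity_of_mem_cutLocus` (`WeinsteinCutLocus.lean`),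
brick "PC-2" of Weinstein's step (3) (metric surgery inside the disk `D`): the new metric inside
`D` must agree with the ambient one on a collar of `∂D`, and the interface
(`RadialIsometryExp.lean`, `RadialBilinearForm.lean`) wants the Gauss-lemma identities of the polar
map in CARTESIAN form on a real inner product space `V`. This file supplies them for the collar.

Let `(M, g)` be a Riemannian manifold with `C^∞` Levi-Civita connection, and let the hypersurface
`∂D` be presented in Cartesian/conical form by maps `ι : V → M`, `ν : Π v, T_{ι v}M` on the inner
product space `V` which are POSITIVELY `0`-HOMOGENEOUS away from `0` (`ι (t v) = ι v`,
`ν (t v) = ν v` for `t > 0`: `v ↦ ι v` is the point of the hypersurface "in the direction `v`"),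
`C^∞` on `V ∖ {0}` as a map into `TM`, with `|ν|_g = 1` and `ν v ⊥_g range dι_v`. The **cone map**

  `C(v) = exp_{ι v}((‖v‖ - 1) ν v)`

sends the unit sphere of `V` to the hypersurface (`‖v‖ = 1 ⇒ C v = ι v`) and the rays of `V` to
the normal geodesics. We prove, at every `v ≠ 0` such that the normal geodesics from the
hypersurface are defined for times in `(-ε, ε) ∋ ‖v‖ - 1`:

* `contMDiffOn_coneMap` — `C` is `C^∞` there;
* `coneMap_of_norm_eq_one` — `C v = ι v` on the unit sphere;
* `mfderiv_coneMap_apply_self` — `dC_v(v) = ‖v‖ · γ'(‖v‖ - 1)`, the (scaled) velocity of the normal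
  geodesic `γ(t) = exp_{ι v}(t ν v)`;
* `val_mfderiv_coneMap_self_self` — **`g(dC_v v, dC_v v) = ‖v‖²`** (normal geodesics have unit
  speed: Lee 2018, Prop. 6.41 (b) / Cor. 5.6);
* `val_mfderiv_coneMap_self_of_inner_eq_zero` — **`g(dC_v v, dC_v β) = 0` for `β ⊥ v`** (the Gauss
  lemma for submanifolds, Lee 2018, Thm. 6.38, in the variation form of `NormalExpGaussLemma.lean`
  applied to the variation of `C` along the great circle through `v` with initial velocity `β`).

Thus `C^* g` is radial (in the sense of `RadialBilinearForm.polarBilin_eq_of_isRadialAt`) on the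
annulus `{|‖v‖ - 1| < ε}`. No sphere manifold is used: the directions are handled through curves in
`V` (rays and great circles) and the chain rule `velocity_comp_of_hasDerivAt`. Injectivity of `C`
and of its differential on the annulus (from the tubular neighbourhood theorem) is the sequel.
No definitions, no named facts (D-0026).

## References

* A. Weinstein, Ann. of Math. 87 (1968) 29–41, step (3) of the proof of the main theorem
  [Weinstein1968]; zbMATH Zbl 0159.23902.
* J. M. Lee, *Introduction to Riemannian Manifolds*, 2nd ed. (2018), Thm. 6.38, Prop. 6.41,
  Cor. 6.42 (Fermi coordinates are semigeodesic) [LeeRiemannianManifolds2018].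
-/

noncomputable section

open Bundle Set Filter Function
open scoped Manifold ContDiff Topology RealInnerProductSpace

namespace Literature.Geometry.Riemannian

open Literature.Geometry.Lorentzian
open Literature.Geometry.Lorentzian.PseudoRiemannianMetric

variable {V : Type*} [NormedAddCommGroup V] [InnerProductSpace ℝ V]
  {E : Type*} [NormedAddCommGroup E] [NormedSpace ℝ E] {H : Type*} [TopologicalSpace H]
  {I : ModelWithCorners ℝ E H} {M : Type*} [TopologicalSpace M] [ChartedSpace H M]
  [IsManifold I ∞ M] {n : ℕ∞ω} [Fact (1 ≤ n)] [FiniteDimensional ℝ E] [CompleteSpace E]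
  [T2Space M] [BoundarylessManifold I M]
  (g : PseudoRiemannianMetric I n E (TangentSpace I : M → Type _)) [g.HasLeviCivita]
  [CovariantDerivative.ContMDiffCovariantDerivative g.leviCivita 1]
  [CovariantDerivative.ContMDiffCovariantDerivative g.leviCivita ((⊤ : ℕ∞) : ℕ∞ω)]
  {ι : V → M} {ν : Π v : V, TangentSpace I (ι v)}

/-! ### Elementary calculus of rays and great circles in `V` -/

omit [Fact (1 ≤ n)] [FiniteDimensional ℝ E] [CompleteSpace E] [T2Space M] [BoundarylessManifold I M]
  [g.HasLeviCivita] [CovariantDerivative.ContMDiffCovariantDerivative g.leviCivita 1]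
  [CovariantDerivative.ContMDiffCovariantDerivative g.leviCivita ((⊤ : ℕ∞) : ℕ∞ω)] in
/-- The ray `s ↦ (1 + s) v` has derivative `v`. [folklore] -/
theorem hasDerivAt_ray (v : V) (s : ℝ) : HasDerivAt (fun s : ℝ ↦ (1 + s) • v) v s := by
  have h := ((hasDerivAt_id s).const_add 1).smul_const v
  simpa using h

/-- Norm of a point of the ray: `‖(1 + s) v‖ = (1 + s) ‖v‖` for `s > -1`. [folklore] -/
theorem norm_ray {v : V} {s : ℝ} (hs : -1 < s) : ‖(1 + s) • v‖ = (1 + s) * ‖v‖ := by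
  rw [norm_smul, Real.norm_eq_abs, abs_of_pos (by linarith)]

/-- The great circle through `v` with initial velocity `β ⊥ v` (`β ≠ 0`, `v ≠ 0`):
`γ(s) = cos(θ s) v + sin(θ s) (‖v‖/‖β‖) β`, `θ = ‖β‖/‖v‖`. Its norm is constant `= ‖v‖`.
[folklore] -/
theorem norm_greatCircle {v β : V} (hv : v ≠ 0) (hβ : β ≠ 0) (h : ⟪v, β⟫ = 0) (s : ℝ) :
    ‖Real.cos (‖β‖ / ‖v‖ * s) • v + Real.sin (‖β‖ / ‖v‖ * s) • ((‖v‖ / ‖β‖) • β)‖ = ‖v‖ := by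
  have hvn : 0 < ‖v‖ := norm_pos_iff.2 hv
  have hβn : 0 < ‖β‖ := norm_pos_iff.2 hβ
  set a := Real.cos (‖β‖ / ‖v‖ * s) with ha
  set b := Real.sin (‖β‖ / ‖v‖ * s) with hb
  have horth : ⟪a • v, b • ((‖v‖ / ‖β‖) • β)⟫ = 0 := by
    rw [inner_smul_left, inner_smul_right, inner_smul_right, h]
    simp
  have h1 : ‖a • v + b • ((‖v‖ / ‖β‖) • β)‖ * ‖a • v + b • ((‖v‖ / ‖β‖) • β)‖ =
      ‖a • v‖ * ‖a • v‖ + ‖b • ((‖v‖ / ‖β‖) • β)‖ * ‖b • ((‖v‖ / ‖β‖) • β)‖ :=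
    norm_add_sq_eq_norm_sq_add_norm_sq_of_inner_eq_zero _ _ horth
  have h2 : ‖a • v‖ = |a| * ‖v‖ := by rw [norm_smul, Real.norm_eq_abs]
  have h3 : ‖b • ((‖v‖ / ‖β‖) • β)‖ = |b| * ‖v‖ := by
    rw [norm_smul, norm_smul, Real.norm_eq_abs, Real.norm_eq_abs, abs_of_pos (div_pos hvn hβn),
      div_mul_cancel₀ _ hβn.ne']
  rw [h2, h3] at h1
  have h4 : ‖a • v + b • ((‖v‖ / ‖β‖) • β)‖ * ‖a • v + b • ((‖v‖ / ‖β‖) • β)‖ = ‖v‖ * ‖v‖ := by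
    rw [h1]
    have hab : a ^ 2 + b ^ 2 = 1 := by rw [ha, hb]; exact Real.cos_sq_add_sin_sq _
    nlinarith [sq_abs a, sq_abs b]
  have hnn : 0 ≤ ‖a • v + b • ((‖v‖ / ‖β‖) • β)‖ := norm_nonneg _
  nlinarith [hnn, hvn]

/-- The great circle starts at `v`. [folklore] -/
theorem greatCircle_zero (v β : V) :
    Real.cos (‖β‖ / ‖v‖ * 0) • v + Real.sin (‖β‖ / ‖v‖ * 0) • ((‖v‖ / ‖β‖) • β) = v := by
  simp

/-- The great circle has initial velocity `β` (`v, β ≠ 0`). [folklore] -/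
theorem hasDerivAt_greatCircle_zero {v β : V} (hv : v ≠ 0) (hβ : β ≠ 0) :
    HasDerivAt (fun s : ℝ ↦ Real.cos (‖β‖ / ‖v‖ * s) • v + Real.sin (‖β‖ / ‖v‖ * s) • ((‖v‖ / ‖β‖) • β))
      β 0 := by
  have hvn : ‖v‖ ≠ 0 := norm_ne_zero_iff.2 hv
  have hβn : ‖β‖ ≠ 0 := norm_ne_zero_iff.2 hβ
  have h1 : HasDerivAt (fun s : ℝ ↦ Real.cos (‖β‖ / ‖v‖ * s)) 0 0 := by
    have h := ((hasDerivAt_id' (0 : ℝ)).const_mul (‖β‖ / ‖v‖)).cos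
    simp only [mul_zero, Real.sin_zero, neg_zero, zero_mul, mul_one] at h
    exact h
  have h2 : HasDerivAt (fun s : ℝ ↦ Real.sin (‖β‖ / ‖v‖ * s)) (‖β‖ / ‖v‖) 0 := by
    have h := ((hasDerivAt_id' (0 : ℝ)).const_mul (‖β‖ / ‖v‖)).sin
    simp only [mul_zero, Real.cos_zero, one_mul, mul_one] at h
    exact h
  have h3 := (h1.smul_const v).add (h2.smul_const ((‖v‖ / ‖β‖) • β))
  have h4 : (0 : ℝ) • v + (‖β‖ / ‖v‖) • ((‖v‖ / ‖β‖) • β) = β := by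
    rw [zero_smul, zero_add, smul_smul]
    have : ‖β‖ / ‖v‖ * (‖v‖ / ‖β‖) = 1 := by field_simp
    rw [this, one_smul]
  rw [h4] at h3
  exact h3

omit [InnerProductSpace ℝ V] [Fact (1 ≤ n)] [FiniteDimensional ℝ E] [CompleteSpace E] [T2Space M]
  [BoundarylessManifold I M] [g.HasLeviCivita]
  [CovariantDerivative.ContMDiffCovariantDerivative g.leviCivita 1]
  [CovariantDerivative.ContMDiffCovariantDerivative g.leviCivita ((⊤ : ℕ∞) : ℕ∞ω)] [IsManifold I ∞ M] in
/-- Chain rule: the velocity at `t` of `F ∘ c`, for a curve `c` in the normed space `V` with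
derivative `c'` at `t` and `F : V → M` differentiable at `c t`, is `dF_{c t}(c')` (the sibling of
`velocity_comp_of_hasDerivAt` of `GaussLemma.lean`, there for the model space). [folklore] -/
theorem velocity_comp_of_hasDerivAt_normedSpace [NormedSpace ℝ V] {F : V → M} {c : ℝ → V}
    {c' w : V} {t : ℝ} (hct : c t = w) (hF : MDifferentiableAt 𝓘(ℝ, V) I F w)
    (hc : HasDerivAt c c' t) :
    velocity I (F ∘ c) t = mfderiv 𝓘(ℝ, V) I F w c' := by
  subst hct
  have hline : HasMFDerivAt 𝓘(ℝ, ℝ) 𝓘(ℝ, V) c t ((ContinuousLinearMap.id ℝ ℝ).smulRight c') :=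
    hasMFDerivAt_iff_hasFDerivAt.2 hc.hasFDerivAt
  have hcomp := hF.hasMFDerivAt.comp t hline
  rw [velocity, hcomp.mfderiv]
  show mfderiv 𝓘(ℝ, V) I F (c t) ((1 : ℝ) • c') = _
  rw [one_smul]

omit [InnerProductSpace ℝ V] [Fact (1 ≤ n)] [FiniteDimensional ℝ E] [CompleteSpace E] [T2Space M]
  [BoundarylessManifold I M] [g.HasLeviCivita]
  [CovariantDerivative.ContMDiffCovariantDerivative g.leviCivita 1]
  [CovariantDerivative.ContMDiffCovariantDerivative g.leviCivita ((⊤ : ℕ∞) : ℕ∞ω)] in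
/-- Transport of a value of `g` along an equality of base points (vectors read in `E`). [folklore] -/
private theorem val_eq_of_eq_basePoint'' {x y : M} (h : x = y) (a b : E) :
    g.val x a b = g.val y a b := by
  subst h
  rfl

/-! ### The cone map: smoothness and the value on the unit sphere -/

omit [Fact (1 ≤ n)] in
/-- **`C(v) = exp_{ι v}((‖v‖ - 1) ν v)` is `C^∞` on an open set `U ∌ 0` on which `v ↦ (ι v, ν v)`
is `C^∞` and the times `‖v‖ - 1` lie in the domains of the normal geodesics.** (`exp` is `C^∞` on
its open domain in `TM`, `contMDiffOn_expMap_totalSpace`; the scaled section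
`v ↦ (ι v, (‖v‖ - 1) ν v)` is `C^∞` by `contMDiffAt_totalSpaceMk_smul_prod` and the smoothness of
the norm away from `0`.) [folklore] -/
theorem contMDiffOn_coneMap {U : Set V} (hU : IsOpen U) (h0 : (0 : V) ∉ U)
    (hs : ContMDiffOn 𝓘(ℝ, V) I.tangent ∞
      (fun v ↦ (TotalSpace.mk' E (ι v) (ν v) : TangentBundle I M)) U)
    (hdom : ∀ v ∈ U, (‖v‖ - 1) ∈ maximalGeodesicDomain g.leviCivita (ι v) (ν v)) :
    ContMDiffOn 𝓘(ℝ, V) I ∞ (fun v : V ↦ expMap g.leviCivita (ι v) ((‖v‖ - 1) • ν v)) U := by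
  -- the scaled section is smooth on `U`
  have hsec : ContMDiffOn 𝓘(ℝ, V) I.tangent ∞
      (fun v ↦ (TotalSpace.mk' E (ι v) ((‖v‖ - 1) • ν v) : TangentBundle I M)) U := by
    intro v hv
    have hv0 : v ≠ 0 := fun h ↦ h0 (h ▸ hv)
    have h1 : ContMDiffAt (𝓘(ℝ, V).prod 𝓘(ℝ, ℝ)) I.tangent ∞
        (fun q : V × ℝ ↦ (TotalSpace.mk' E (ι q.1) (q.2 • ν q.1) : TangentBundle I M))
        (v, ‖v‖ - 1) :=
      contMDiffAt_totalSpaceMk_smul_prod ((hs v hv).contMDiffAt (hU.mem_nhds hv)) _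
    have h2 : ContMDiffAt 𝓘(ℝ, V) (𝓘(ℝ, V).prod 𝓘(ℝ, ℝ)) ∞ (fun v : V ↦ (v, ‖v‖ - 1)) v := by
      refine contMDiffAt_id.prodMk ?_
      have h3 : ContDiffAt ℝ ∞ (fun v : V ↦ ‖v‖ - 1) v := (contDiffAt_norm ℝ hv0).sub contDiffAt_const
      exact h3.contMDiffAt
    exact (h1.comp v h2).contMDiffWithinAt
  have hexp := contMDiffOn_expMap_totalSpace (cov := g.leviCivita) (k := (⊤ : ℕ∞)) le_top
  refine (hexp.comp hsec fun v hv ↦ ?_)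
  show (1 : ℝ) ∈ maximalGeodesicDomain g.leviCivita (ι v) ((‖v‖ - 1) • ν v)
  rw [mem_maximalGeodesicDomain_iff_smul_mem_expDomain, one_smul,
    ← mem_maximalGeodesicDomain_iff_smul_mem_expDomain]
  exact hdom v hv

omit [InnerProductSpace ℝ V] [Fact (1 ≤ n)]
  [CovariantDerivative.ContMDiffCovariantDerivative g.leviCivita ((⊤ : ℕ∞) : ℕ∞ω)] in
/-- **On the unit sphere the cone map is the hypersurface**: `‖v‖ = 1 ⇒ C v = ι v`. [folklore] -/
theorem coneMap_of_norm_eq_one {v : V} (hv : ‖v‖ = 1) :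
    expMap g.leviCivita (ι v) ((‖v‖ - 1) • ν v) = ι v := by
  rw [hv, sub_self, zero_smul]
  exact expMap_zero (cov := g.leviCivita) (ι v)

/-! ### The radial direction: `dC_v(v)` is the scaled velocity of the normal geodesic -/

omit [Fact (1 ≤ n)] [CompleteSpace E] [T2Space M] [BoundarylessManifold I M]
  [g.HasLeviCivita] [CovariantDerivative.ContMDiffCovariantDerivative g.leviCivita 1]
  [CovariantDerivative.ContMDiffCovariantDerivative g.leviCivita ((⊤ : ℕ∞) : ℕ∞ω)] in
/-- Geodesics through equal points of `TM` agree (transport along `(ι (t v), ν (t v)) = (ι v, ν v)`).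
[folklore] -/
theorem expMap_smul_congr_totalSpace (cov : CovariantDerivative I E (TangentSpace I : M → Type _))
    {q q' : TangentBundle I M} (h : q = q') (r : ℝ) :
    expMap cov q.proj (r • q.2) = expMap cov q'.proj (r • q'.2) := by
  subst h
  rfl

omit [Fact (1 ≤ n)] in
/-- **`dC_v(v) = ‖v‖ · γ'(‖v‖ - 1)`**, `γ(t) = exp_{ι v}(t ν v)` the normal geodesic: along the ray
`s ↦ (1 + s) v` the cone map is `γ(‖v‖ s + ‖v‖ - 1)` by `0`-homogeneity, and the chain rule
(`velocity_comp_of_hasDerivAt`, `velocity_comp_affine`). [folklore] -/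
theorem mfderiv_coneMap_apply_self {U : Set V} (hU : IsOpen U) (h0 : (0 : V) ∉ U)
    (hs : ContMDiffOn 𝓘(ℝ, V) I.tangent ∞
      (fun v ↦ (TotalSpace.mk' E (ι v) (ν v) : TangentBundle I M)) U)
    (hdom : ∀ v ∈ U, (‖v‖ - 1) ∈ maximalGeodesicDomain g.leviCivita (ι v) (ν v))
    (hhom : ∀ v ∈ U, ∀ t : ℝ, 0 < t →
      (TotalSpace.mk' E (ι (t • v)) (ν (t • v)) : TangentBundle I M) = TotalSpace.mk' E (ι v) (ν v))
    {v : V} (hv : v ∈ U) :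
    mfderiv 𝓘(ℝ, V) I (fun v : V ↦ expMap g.leviCivita (ι v) ((‖v‖ - 1) • ν v)) v v =
      ‖v‖ • velocity I (fun t : ℝ ↦ expMap g.leviCivita (ι v) (t • ν v)) (‖v‖ - 1) := by
  have hv0 : v ≠ 0 := fun h ↦ h0 (h ▸ hv)
  set C : V → M := fun v ↦ expMap g.leviCivita (ι v) ((‖v‖ - 1) • ν v) with hC
  have hCd : MDifferentiableAt 𝓘(ℝ, V) I C v :=
    ((contMDiffOn_coneMap g hU h0 hs hdom v hv).contMDiffAt (hU.mem_nhds hv)).mdifferentiableAt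
      (by simp)
  -- chain rule along the ray
  have h1 : velocity I (C ∘ fun s : ℝ ↦ (1 + s) • v) 0 = mfderiv 𝓘(ℝ, V) I C v v :=
    velocity_comp_of_hasDerivAt_normedSpace (F := C) (c := fun s : ℝ ↦ (1 + s) • v) (t := 0)
      (w := v) (by simp) hCd (hasDerivAt_ray v 0)
  -- along the ray, `C ((1+s) v) = γ (‖v‖ s + (‖v‖ - 1))` for `s > -1`
  set γ : ℝ → M := fun t ↦ expMap g.leviCivita (ι v) (t • ν v) with hγ
  have h2 : (C ∘ fun s : ℝ ↦ (1 + s) • v) =ᶠ[𝓝 (0 : ℝ)] fun s ↦ γ (‖v‖ * s + (‖v‖ - 1)) := by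
    have hnhd : Ioi (-1 : ℝ) ∈ 𝓝 (0 : ℝ) := Ioi_mem_nhds (by norm_num)
    filter_upwards [hnhd] with s hs
    have hs' : -1 < s := hs
    show expMap g.leviCivita (ι ((1 + s) • v)) ((‖(1 + s) • v‖ - 1) • ν ((1 + s) • v)) =
      expMap g.leviCivita (ι v) ((‖v‖ * s + (‖v‖ - 1)) • ν v)
    rw [norm_ray hs', show ‖v‖ * s + (‖v‖ - 1) = (1 + s) * ‖v‖ - 1 by ring]
    exact expMap_smul_congr_totalSpace g.leviCivita (hhom v hv (1 + s) (by linarith))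
      ((1 + s) * ‖v‖ - 1)
  rw [← h1, velocity_congr_of_eventuallyEq h2, velocity_comp_affine γ ‖v‖ (‖v‖ - 1) 0]
  have key : ∀ t : ℝ, t = ‖v‖ - 1 →
      (‖v‖ • velocity I γ t : E) = ‖v‖ • velocity I γ (‖v‖ - 1) := by
    rintro t rfl
    rfl
  exact key _ (by ring)

/-! ### The Gauss identities of the cone map -/

/-- **Radial Gauss identity: `g(dC_v v, dC_v v) = ‖v‖² g(ν v, ν v)`** (`= ‖v‖²` for a unit normal):
`dC_v v = ‖v‖ γ'` (`mfderiv_coneMap_apply_self`) and normal geodesics have constant speed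
(`val_velocity_normalVariation_self`; Lee 2018, Prop. 6.41 (b)). [cite: LeeRiemannianManifolds2018, Prop. 6.41 (b)] -/
theorem val_mfderiv_coneMap_self_self {U : Set V} (hU : IsOpen U) (h0 : (0 : V) ∉ U)
    (hs : ContMDiffOn 𝓘(ℝ, V) I.tangent ∞
      (fun v ↦ (TotalSpace.mk' E (ι v) (ν v) : TangentBundle I M)) U)
    (hdom : ∀ v ∈ U, (‖v‖ - 1) ∈ maximalGeodesicDomain g.leviCivita (ι v) (ν v))
    (hhom : ∀ v ∈ U, ∀ t : ℝ, 0 < t →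
      (TotalSpace.mk' E (ι (t • v)) (ν (t • v)) : TangentBundle I M) = TotalSpace.mk' E (ι v) (ν v))
    {v : V} (hv : v ∈ U) :
    g.val (expMap g.leviCivita (ι v) ((‖v‖ - 1) • ν v))
        (mfderiv 𝓘(ℝ, V) I (fun v : V ↦ expMap g.leviCivita (ι v) ((‖v‖ - 1) • ν v)) v v)
        (mfderiv 𝓘(ℝ, V) I (fun v : V ↦ expMap g.leviCivita (ι v) ((‖v‖ - 1) • ν v)) v v) =
      ‖v‖ ^ 2 * g.val (ι v) (ν v) (ν v) := by
  rw [mfderiv_coneMap_apply_self g hU h0 hs hdom hhom hv]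
  have h := val_velocity_normalVariation_self g (c := fun _ : ℝ ↦ ι v) (fun _ ↦ ν v) 0 (hdom v hv)
  simp only [map_smul, FunLike.coe_smul, Pi.smul_apply, smul_eq_mul]
  rw [h]
  ring

/-- **Angular Gauss identity: `g(dC_v v, dC_v β) = 0` for `β ⊥ v`** — the Gauss lemma for
submanifolds (Lee 2018, Thm. 6.38) along the variation of the cone map through the great circle
`γ(s) = cos(θs) v + sin(θs)(‖v‖/‖β‖)β` (`θ = ‖β‖/‖v‖`; `‖γ s‖ = ‖v‖`, `γ 0 = v`, `γ'(0) = β`):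
`s ↦ C(γ s) = exp_{ι γ s}((‖v‖ - 1) ν γ s)` is a variation through normal geodesics of a field of
constant length `1` which is `g`-orthogonal to the base curve `ι ∘ γ` (`ν ⊥ range dι`), so
`val_velocity_normalVariation_eq_zero_of_mem_maximalGeodesicDomain` applies; the two velocities
are `dC_v β` and `γ'_ν = dC_v v / ‖v‖` by the chain rule. Hypotheses: on the open set `U ∌ 0`,
`v ↦ (ι v, ν v)` is `C^∞`, positively `0`-homogeneous, `|ν|_g = 1`, `ν v ⊥ range dι_v`, and the
normal geodesics are defined for all times in `(-ε, ε)`; `v ∈ U` with `|‖v‖ - 1| < ε` and the whole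
sphere `{‖w‖ = ‖v‖}` inside `U`. [cite: LeeRiemannianManifolds2018, Thm. 6.38] -/
theorem val_mfderiv_coneMap_self_of_inner_eq_zero {U : Set V} (hU : IsOpen U) (h0 : (0 : V) ∉ U)
    (hs : ContMDiffOn 𝓘(ℝ, V) I.tangent ∞
      (fun v ↦ (TotalSpace.mk' E (ι v) (ν v) : TangentBundle I M)) U)
    {ε : ℝ} (hε : 0 < ε)
    (hdomε : ∀ v ∈ U, ∀ t ∈ Ioo (-ε) ε, t ∈ maximalGeodesicDomain g.leviCivita (ι v) (ν v))
    (hhom : ∀ v ∈ U, ∀ t : ℝ, 0 < t →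
      (TotalSpace.mk' E (ι (t • v)) (ν (t • v)) : TangentBundle I M) = TotalSpace.mk' E (ι v) (ν v))
    (hunit : ∀ v ∈ U, g.val (ι v) (ν v) (ν v) = 1)
    (hperp : ∀ v ∈ U, ∀ z : V, g.val (ι v) (mfderiv 𝓘(ℝ, V) I ι v z) (ν v) = 0)
    {v : V} (hvε : ‖v‖ - 1 ∈ Ioo (-ε) ε) (hsph : ∀ w : V, ‖w‖ = ‖v‖ → w ∈ U)
    {β : V} (hβ : ⟪v, β⟫ = 0) :
    g.val (expMap g.leviCivita (ι v) ((‖v‖ - 1) • ν v))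
        (mfderiv 𝓘(ℝ, V) I (fun v : V ↦ expMap g.leviCivita (ι v) ((‖v‖ - 1) • ν v)) v v)
        (mfderiv 𝓘(ℝ, V) I (fun v : V ↦ expMap g.leviCivita (ι v) ((‖v‖ - 1) • ν v)) v β) = 0 := by
  have hv : v ∈ U := hsph v rfl
  have hv0 : v ≠ 0 := fun h ↦ h0 (h ▸ hv)
  set C : V → M := fun v ↦ expMap g.leviCivita (ι v) ((‖v‖ - 1) • ν v) with hC
  -- the case `β = 0`
  by_cases hβ0 : β = 0
  · subst hβ0
    show g.val (C v) (mfderiv 𝓘(ℝ, V) I C v v)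
      (mfderiv 𝓘(ℝ, V) I C v (0 : TangentSpace 𝓘(ℝ, V) v)) = 0
    rw [map_zero, map_zero]
  -- the great circle
  set γc : ℝ → V := fun s ↦ Real.cos (‖β‖ / ‖v‖ * s) • v + Real.sin (‖β‖ / ‖v‖ * s) • ((‖v‖ / ‖β‖) • β)
    with hγc
  have hγn : ∀ s, ‖γc s‖ = ‖v‖ := fun s ↦ norm_greatCircle hv0 hβ0 hβ s
  have hγU : ∀ s, γc s ∈ U := fun s ↦ hsph _ (hγn s)
  have hγ0 : γc 0 = v := greatCircle_zero v β
  have hγd : HasDerivAt γc β 0 := hasDerivAt_greatCircle_zero hv0 hβ0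
  have hγs : ContDiff ℝ ∞ γc := by
    have h1 : ContDiff ℝ ∞ fun s : ℝ ↦ ‖β‖ / ‖v‖ * s := contDiff_const.mul contDiff_id
    exact ((Real.contDiff_cos.comp h1).smul contDiff_const).add
      ((Real.contDiff_sin.comp h1).smul contDiff_const)
  -- the restricted domain hypothesis on the sphere through `v`
  have hdomγ : ∀ s, (‖γc s‖ - 1) ∈ maximalGeodesicDomain g.leviCivita (ι (γc s)) (ν (γc s)) :=
    fun s ↦ hdomε _ (hγU s) _ (by rw [hγn s]; exact hvε)
  -- `C` is differentiable at the points of the sphere (an open set of good points around each)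
  have hCd : ∀ s, MDifferentiableAt 𝓘(ℝ, V) I C (γc s) := by
    intro s
    -- the open set `U ∩ {w | ‖w‖ - 1 ∈ (-ε, ε)}` contains `γc s`
    set U' : Set V := U ∩ {w : V | ‖w‖ - 1 ∈ Ioo (-ε) ε} with hU'
    have hU'o : IsOpen U' :=
      hU.inter ((isOpen_Ioo.preimage (continuous_norm.sub continuous_const)))
    have hmem : γc s ∈ U' := ⟨hγU s, by show ‖γc s‖ - 1 ∈ Ioo (-ε) ε; rw [hγn s]; exact hvε⟩
    have h0' : (0 : V) ∉ U' := fun h ↦ h0 h.1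
    have hCs := contMDiffOn_coneMap g hU'o h0' (hs.mono inter_subset_left)
      (fun w hw ↦ hdomε w hw.1 _ hw.2)
    exact ((hCs _ hmem).contMDiffAt (hU'o.mem_nhds hmem)).mdifferentiableAt (by simp)
  -- `ι` is differentiable on `U`
  have hιd : ∀ w ∈ U, MDifferentiableAt 𝓘(ℝ, V) I ι w := by
    intro w hw
    have h1 : ContMDiffAt 𝓘(ℝ, V) I.tangent ∞
        (fun v ↦ (TotalSpace.mk' E (ι v) (ν v) : TangentBundle I M)) w :=
      (hs w hw).contMDiffAt (hU.mem_nhds hw)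
    have h2 : ContMDiffAt 𝓘(ℝ, V) I ∞ ι w := by
      rw [ModelWithCorners.tangent, Bundle.contMDiffAt_totalSpace] at h1
      exact h1.1
    exact h2.mdifferentiableAt (by simp)
  /- the Gauss lemma along the variation `x(t, s) = exp_{ι γ s}(t ν γ s)` -/
  set c : ℝ → M := fun s ↦ ι (γc s) with hc
  set Vf : Π s : ℝ, TangentSpace I (c s) := fun s ↦ ν (γc s) with hVf
  have hcV : ∀ s ∈ Ioo (-(1 : ℝ)) 1, ContMDiffAt 𝓘(ℝ, ℝ) I.tangent ∞
      (fun s ↦ (TotalSpace.mk' E (c s) (Vf s) : TangentBundle I M)) s := by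
    intro s _
    have h1 : ContMDiffAt 𝓘(ℝ, V) I.tangent ∞
        (fun v ↦ (TotalSpace.mk' E (ι v) (ν v) : TangentBundle I M)) (γc s) :=
      (hs _ (hγU s)).contMDiffAt (hU.mem_nhds (hγU s))
    exact h1.comp s hγs.contMDiff.contMDiffAt
  have hstrip : ∀ t ∈ Ioo (-ε) ε, ∀ s ∈ Ioo (-(1 : ℝ)) 1,
      t ∈ maximalGeodesicDomain g.leviCivita (c s) (Vf s) :=
    fun t ht s _ ↦ hdomε _ (hγU s) t ht
  have hVV : ∀ s ∈ Ioo (-(1 : ℝ)) 1, g.val (c s) (Vf s) (Vf s) = g.val (c 0) (Vf 0) (Vf 0) := by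
    intro s _
    show g.val (ι (γc s)) (ν (γc s)) (ν (γc s)) = g.val (ι (γc 0)) (ν (γc 0)) (ν (γc 0))
    rw [hunit _ (hγU s), hunit _ (hγU 0)]
  have hperp0 : g.val (c 0) (velocity I c 0) (Vf 0) = 0 := by
    have h1 : velocity I c 0 = mfderiv 𝓘(ℝ, V) I ι (γc 0) β :=
      velocity_comp_of_hasDerivAt_normedSpace (F := ι) (c := γc) (t := 0) (w := γc 0) rfl
        (hιd _ (hγU 0)) hγd
    rw [h1]
    exact hperp _ (hγU 0) β
  have L := val_velocity_normalVariation_eq_zero_of_mem_maximalGeodesicDomain g (k := (⊤ : ℕ∞))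
    rfl (c := c) (V := Vf) one_pos (by linarith : -ε < 0) hε hcV hstrip hVV hperp0 (t := ‖v‖ - 1)
    hvε
  /- identification of the two velocities with `dC β` and `dC v / ‖v‖` at the point `γc 0` -/
  -- `∂_s x(‖v‖ - 1, 0) = velocity (C ∘ γc) 0 = dC_{γc 0}(β)`
  have hfun : (fun s ↦ expMap g.leviCivita (c s) ((‖v‖ - 1) • Vf s)) = C ∘ γc := by
    funext s
    show expMap g.leviCivita (ι (γc s)) ((‖v‖ - 1) • ν (γc s)) =
      expMap g.leviCivita (ι (γc s)) ((‖γc s‖ - 1) • ν (γc s))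
    rw [hγn s]
  have hS : velocity I (fun s ↦ expMap g.leviCivita (c s) ((‖v‖ - 1) • Vf s)) 0 =
      mfderiv 𝓘(ℝ, V) I C (γc 0) β := by
    rw [velocity_congr_of_eventuallyEq (Filter.EventuallyEq.of_eq hfun.symm).symm]
    exact velocity_comp_of_hasDerivAt_normedSpace (F := C) (c := γc) (t := 0) (w := γc 0) rfl
      (hCd 0) hγd
  -- the statement at the point `γc 0`, then transported to `v`
  have key : ∀ w : V, γc 0 = w →
      g.val (C w) (mfderiv 𝓘(ℝ, V) I C w w) (mfderiv 𝓘(ℝ, V) I C w β) = 0 := by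
    rintro w hw
    subst hw
    -- `dC_{γc 0}(γc 0) = ‖γc 0‖ • γ'_{ν}(‖γc 0‖ - 1)` with the radial lemma on `U'`
    set U' : Set V := U ∩ {w : V | ‖w‖ - 1 ∈ Ioo (-ε) ε} with hU'
    have hU'o : IsOpen U' :=
      hU.inter ((isOpen_Ioo.preimage (continuous_norm.sub continuous_const)))
    have hmem : γc 0 ∈ U' := ⟨hγU 0, by show ‖γc 0‖ - 1 ∈ Ioo (-ε) ε; rw [hγn 0]; exact hvε⟩
    have h0' : (0 : V) ∉ U' := fun h ↦ h0 h.1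
    have hrad := mfderiv_coneMap_apply_self g hU'o h0' (hs.mono inter_subset_left)
      (fun w hw ↦ hdomε w hw.1 _ hw.2) (fun w hw t ht ↦ hhom w hw.1 t ht) hmem
    have hrad' : mfderiv 𝓘(ℝ, V) I C (γc 0) (γc 0) =
        ‖γc 0‖ • velocity I (fun t : ℝ ↦ expMap g.leviCivita (ι (γc 0)) (t • ν (γc 0)))
          (‖γc 0‖ - 1) := hrad
    -- `L` read at the base point `C (γc 0)`
    have hpt : expMap g.leviCivita (c 0) ((‖v‖ - 1) • Vf 0) = C (γc 0) := by
      show expMap g.leviCivita (ι (γc 0)) ((‖v‖ - 1) • ν (γc 0)) =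
        expMap g.leviCivita (ι (γc 0)) ((‖γc 0‖ - 1) • ν (γc 0))
      rw [hγn 0]
    have L' : g.val (C (γc 0))
        (velocity I (fun s ↦ expMap g.leviCivita (c s) ((‖v‖ - 1) • Vf s)) 0)
        (velocity I (fun t ↦ expMap g.leviCivita (c 0) (t • Vf 0)) (‖v‖ - 1)) = 0 :=
      (val_eq_of_eq_basePoint'' (g := g) hpt _ _).symm.trans L
    -- time reparametrisation `‖γc 0‖ = ‖v‖`
    have key2 : ∀ τ : ℝ, τ = ‖v‖ →
        g.val (C (γc 0)) (τ • velocity I (fun t : ℝ ↦ expMap g.leviCivita (ι (γc 0))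
          (t • ν (γc 0))) (τ - 1)) (mfderiv 𝓘(ℝ, V) I C (γc 0) β) = 0 := by
      rintro τ rfl
      have e1 : g.val (C (γc 0)) (‖v‖ • velocity I (fun t : ℝ ↦ expMap g.leviCivita (ι (γc 0))
            (t • ν (γc 0))) (‖v‖ - 1)) (mfderiv 𝓘(ℝ, V) I C (γc 0) β) =
          ‖v‖ • g.val (C (γc 0)) (velocity I (fun t : ℝ ↦ expMap g.leviCivita (ι (γc 0))
            (t • ν (γc 0))) (‖v‖ - 1)) (mfderiv 𝓘(ℝ, V) I C (γc 0) β) :=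
        ContinuousLinearMap.map_smul₂ _ _ _ _
      rw [e1, ← hS, g.symm (C (γc 0)), L', smul_zero]
    show g.val (C (γc 0)) (mfderiv 𝓘(ℝ, V) I C (γc 0) (γc 0)) (mfderiv 𝓘(ℝ, V) I C (γc 0) β) = 0
    rw [hrad']
    exact key2 _ (hγn 0)
  exact key v hγ0

end Literature.Geometry.Riemannian

end
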